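import Mathlib.Algebra.BigOperators.Fin
import Mathlib.Algebra.BigOperators.GroupWithZero.Finset
import Mathlib.Data.Fintype.EquivFin
import Literature.Computability.AlgebraicComplexity.MatrixMultiplicationExponent
import Literature.Computability.AlgebraicComplexity.AsymptoticSpectrum
import Literature.Computability.AlgebraicComplexity.TensorRestrictionRank
import Literature.Computability.AlgebraicComplexity.CoppersmithWinograd1990Proofs
import HarnessLib

/-!
# Laser method for tensors with the Coppersmith–Winograd block structure and SIGNED block values
(route `MatrixMultiplication/AsymptoticRankCW`, support item `GlueDet3Omega` = `stmt-MatrixMultiplication-1889`)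

The tensor-algebra half of the Coppersmith–Winograd "easy" bound, generalised from the little
Coppersmith–Winograd tensor `T_cw,q` (`CwLaserBlocks.lean`, BCS 1997 §15.8) to every tensor
`T ∈ (K^{q+1})^{⊗3}` whose support with respect to the blocks `{0} ∪ {1,…,q}` is
`{(0,1,1),(1,0,1),(1,1,0)}` and whose three blocks are *signed permutation matrices*:
`T(0,x+1,y+1) = [y = σ₁ x] s₁ x`, `T(x+1,0,y+1) = [y = σ₂ x] s₂ x`, `T(x+1,y+1,0) = [y = σ₃ x] s₃ x`
with `σᵢ` injective and `sᵢ x ∈ {±1}` (so each block is isomorphic to a matrix product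
`⟨1,1,q⟩, ⟨q,1,1⟩, ⟨1,q,1⟩` — "the same block structure as `T_cw,q`", Conner–Gesmundo–Landsberg–Ventura
2022 §2.2, which is all the laser method uses).  Instances: `T_cw,q` (`σ = id`, `s = 1`), the skew
cousin `T_skewcw,q` (CGLV eq. (3)), and the Levi-Civita tensor `Λ³ℂ³ ≅ T_skewcw,2` of the route's
crux `BDet3AsymptoticRank`.

* `signedCw_block_diag`, `signedCw_block_support` — one block of `T^{⊗N}` along an ordered
  partition `(A,B,C)` of the positions is `⟨q^{|C|},q^{|A|},q^{|B|}⟩` up to a sign factoring as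
  `(sign of the a-index)·(sign of the b-index)`, once the `σᵢ` are absorbed into the index maps;
  off the partitions the blocks vanish.
* `signedCw_kroneckerPow_blocks` — along a free diagonal `Δ` of balanced ordered partitions,
  `⟨|Δ|⟩ ⊗ ⟨q^m,q^m,q^m⟩ = φ(x) ψ(y) · T^{⊗N}(F x, G y, H z)` (BCS p. 381, `⊕_Δ t^{⊗N}(x,y,z) ≤ t^{⊗N}`).
* `tensorRestrictsTo_precomp_mul`, `exists_restrictsTo_signedCw_kroneckerPow` —
  `T^{⊗3m} ≥ ⟨p_m⟩ ⊗ ⟨q^m,q^m,q^m⟩`, `288 C(2m,m) p_m ≥ C(3m,m) · rothNumberNat(3 C(2m,m))`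
  (free diagonal of `exists_free_balanced_diagonal`, `CoppersmithWinograd1990Proofs.lean`).

Everything is proved; no definitions (index maps and signs are exhibited inside the proofs).

References: P. Bürgisser, M. Clausen, M. A. Shokrollahi, *Algebraic Complexity Theory* (1997),
§15.6–15.8 (Thm. 15.41, pp. 380–383); A. Conner, F. Gesmundo, J. M. Landsberg, E. Ventura,
comput. complexity 31 (2022) = arXiv:1909.04785, §2.2.
-/

-- the Theorems namespace `Summit.MatrixMultiplication.MatrixMultiplication.Theorems` repeats the
-- summit name by design (single-problem summit, D-0017), which trips `linter.dupNamespace`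
set_option linter.dupNamespace false

noncomputable section

open scoped BigOperators
open Finset Literature.Computability.AlgebraicComplexity

namespace Summit.MatrixMultiplication.MatrixMultiplication.Theorems

universe u

variable {K : Type u} [CommRing K]

/-! ## One block of `T^{⊗N}` -/

section Block

/-- A product of signed indicators is the signed indicator of the conjunction:
`∏_r [u r = v r] w r = [u = v] ∏_r w r`. [folklore] -/
theorem prod_ite_eq_fun {m q : ℕ} (u v : Fin m → Fin q) (w : Fin m → K) :
    ∏ r, (if v r = u r then w r else 0) = if u = v then ∏ r, w r else 0 := by
  classical
  by_cases h : u = v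
  · subst h
    rw [if_pos rfl]
    exact Finset.prod_congr rfl fun r _ => if_pos rfl
  · rw [if_neg h]
    obtain ⟨r, hr⟩ := Function.ne_iff.1 h
    exact Finset.prod_eq_zero (Finset.mem_univ r) (if_neg (Ne.symm hr))

/-- **The diagonal blocks of `T^{⊗N}` are signed matrix multiplication tensors** (BCS p. 381:
`t^{⊗N}(x,y,z) ≃ ⊗_ρ t(x_ρ,y_ρ,z_ρ)`), for a tensor `T` with signed-permutation blocks
`T(0,x+1,y+1) = [y = σ₁ x] s₁ x`, `T(x+1,0,y+1) = [y = σ₂ x] s₂ x`, `T(x+1,y+1,0) = [y = σ₃ x] s₃ x`: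
along an ordered partition `(A,B,C)` of the positions (`|A| = |B| = |C| = m`), the indices
`a` (zero on `A`, `κ` on `C`, `ν` on `B`), `b` (zero on `B`, `σ₃ ∘ κ'` on `C`, `μ` on `A`),
`c` (zero on `C`, `σ₁ ∘ μ'` on `A`, `σ₂ ∘ ν'` on `B`) give
`∏_ρ T(a_ρ,b_ρ,c_ρ) = [κ = κ'][μ = μ'][ν = ν'] · ∏ s₁(μ) ∏ s₂(ν) ∏ s₃(κ)`.
[cite: BurgisserClausenShokrollahi1997, Thm. 15.41 (proof, p. 381)] -/
theorem signedCw_block_diag {N q m : ℕ} (T : Fin (q + 1) → Fin (q + 1) → Fin (q + 1) → K)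
    (σ₁ σ₂ σ₃ : Fin q → Fin q) (hσ₁ : Function.Injective σ₁) (hσ₂ : Function.Injective σ₂)
    (hσ₃ : Function.Injective σ₃) (s₁ s₂ s₃ : Fin q → K)
    (hT₁ : ∀ x y, T 0 x.succ y.succ = if y = σ₁ x then s₁ x else 0)
    (hT₂ : ∀ x y, T x.succ 0 y.succ = if y = σ₂ x then s₂ x else 0)
    (hT₃ : ∀ x y, T x.succ y.succ 0 = if y = σ₃ x then s₃ x else 0)
    {A B C : Finset (Fin N)} (hAB : Disjoint A B)
    (hAC : Disjoint A C) (hBC : Disjoint B C) (hcov : A ∪ B ∪ C = Finset.univ)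
    (eA : ↥A ≃ Fin m) (eB : ↥B ≃ Fin m) (eC : ↥C ≃ Fin m) (κ ν κ' μ μ' ν' : Fin m → Fin q)
    (a b c : Fin N → Fin (q + 1))
    (ha0 : ∀ ρ ∈ A, a ρ = 0) (haC : ∀ ρ (h : ρ ∈ C), a ρ = (κ (eC ⟨ρ, h⟩)).succ)
    (haB : ∀ ρ (h : ρ ∈ B), a ρ = (ν (eB ⟨ρ, h⟩)).succ)
    (hb0 : ∀ ρ ∈ B, b ρ = 0) (hbC : ∀ ρ (h : ρ ∈ C), b ρ = (σ₃ (κ' (eC ⟨ρ, h⟩))).succ)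
    (hbA : ∀ ρ (h : ρ ∈ A), b ρ = (μ (eA ⟨ρ, h⟩)).succ)
    (hc0 : ∀ ρ ∈ C, c ρ = 0) (hcA : ∀ ρ (h : ρ ∈ A), c ρ = (σ₁ (μ' (eA ⟨ρ, h⟩))).succ)
    (hcB : ∀ ρ (h : ρ ∈ B), c ρ = (σ₂ (ν' (eB ⟨ρ, h⟩))).succ) :
    ∏ ρ, T (a ρ) (b ρ) (c ρ) =
      if κ = κ' ∧ μ = μ' ∧ ν = ν' then (∏ r, s₁ (μ r)) * (∏ r, s₂ (ν r)) * ∏ r, s₃ (κ r)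
      else 0 := by
  classical
  have hAuBC : Disjoint (A ∪ B) C := Finset.disjoint_union_left.2 ⟨hAC, hBC⟩
  rw [← hcov, Finset.prod_union hAuBC, Finset.prod_union hAB]
  -- the three partial products
  have hA : ∏ ρ ∈ A, T (a ρ) (b ρ) (c ρ) = ∏ r, if μ' r = μ r then s₁ (μ r) else 0 := by
    rw [← Finset.prod_coe_sort A]
    refine Fintype.prod_equiv eA _ _ fun i => ?_
    rw [ha0 _ i.2, hbA _ i.2, hcA _ i.2, hT₁]
    simp only [Subtype.coe_eta]
    by_cases h : μ' (eA i) = μ (eA i)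
    · rw [if_pos h, if_pos (congrArg σ₁ h)]
    · rw [if_neg h, if_neg fun h' => h (hσ₁ h')]
  have hB : ∏ ρ ∈ B, T (a ρ) (b ρ) (c ρ) = ∏ r, if ν' r = ν r then s₂ (ν r) else 0 := by
    rw [← Finset.prod_coe_sort B]
    refine Fintype.prod_equiv eB _ _ fun i => ?_
    rw [hb0 _ i.2, haB _ i.2, hcB _ i.2, hT₂]
    simp only [Subtype.coe_eta]
    by_cases h : ν' (eB i) = ν (eB i)
    · rw [if_pos h, if_pos (congrArg σ₂ h)]
    · rw [if_neg h, if_neg fun h' => h (hσ₂ h')]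
  have hC : ∏ ρ ∈ C, T (a ρ) (b ρ) (c ρ) = ∏ r, if κ' r = κ r then s₃ (κ r) else 0 := by
    rw [← Finset.prod_coe_sort C]
    refine Fintype.prod_equiv eC _ _ fun i => ?_
    rw [hc0 _ i.2, haC _ i.2, hbC _ i.2, hT₃]
    simp only [Subtype.coe_eta]
    by_cases h : κ' (eC i) = κ (eC i)
    · rw [if_pos h, if_pos (congrArg σ₃ h)]
    · rw [if_neg h, if_neg fun h' => h (hσ₃ h')]
  rw [hA, hB, hC, prod_ite_eq_fun μ μ' (fun r => s₁ (μ r)), prod_ite_eq_fun ν ν' (fun r => s₂ (ν r)),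
    prod_ite_eq_fun κ κ' (fun r => s₃ (κ r))]
  by_cases h : κ = κ' ∧ μ = μ' ∧ ν = ν'
  · rw [if_pos h, if_pos h.1, if_pos h.2.1, if_pos h.2.2]
  · rw [if_neg h]
    by_cases hκ : κ = κ'
    · by_cases hμ : μ = μ'
      · have hν : ν ≠ ν' := fun hν => h ⟨hκ, hμ, hν⟩
        rw [if_neg hν, mul_zero, zero_mul]
      · rw [if_neg hμ, zero_mul, zero_mul]
    · rw [if_neg hκ, mul_zero]

/-- **Off-diagonal blocks vanish unless the zero sets form a partition** (BCS p. 372/381: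
`supp_{D^{⊗N}} t^{⊗N} = (supp_D t)^N` with `supp_D t = {(0,1,1),(1,0,1),(1,1,0)}`): if every
non-zero entry of `T` has exactly one zero coordinate and `∏_ρ T(a_ρ,b_ρ,c_ρ) ≠ 0`, then the zero
sets of `a, b, c` are pairwise disjoint and cover all positions.
[cite: BurgisserClausenShokrollahi1997, Thm. 15.41 (proof, p. 381)] -/
theorem signedCw_block_support {N q : ℕ} (T : Fin (q + 1) → Fin (q + 1) → Fin (q + 1) → K)
    (hsupp : ∀ i j k, T i j k ≠ 0 →
      (i = 0 ∧ j ≠ 0 ∧ k ≠ 0) ∨ (j = 0 ∧ i ≠ 0 ∧ k ≠ 0) ∨ (k = 0 ∧ i ≠ 0 ∧ j ≠ 0))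
    {A B C : Finset (Fin N)} (a b c : Fin N → Fin (q + 1))
    (ha : ∀ ρ, a ρ = 0 ↔ ρ ∈ A) (hb : ∀ ρ, b ρ = 0 ↔ ρ ∈ B) (hc : ∀ ρ, c ρ = 0 ↔ ρ ∈ C)
    (hne : ∏ ρ, T (a ρ) (b ρ) (c ρ) ≠ 0) :
    Disjoint A B ∧ Disjoint A C ∧ Disjoint B C ∧ A ∪ B ∪ C = Finset.univ := by
  classical
  have hρ : ∀ ρ, T (a ρ) (b ρ) (c ρ) ≠ 0 := fun ρ h =>
    hne (Finset.prod_eq_zero (Finset.mem_univ ρ) h)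
  have hpat := fun ρ => hsupp _ _ _ (hρ ρ)
  refine ⟨Finset.disjoint_left.2 fun ρ hA hB => ?_, Finset.disjoint_left.2 fun ρ hA hC => ?_,
    Finset.disjoint_left.2 fun ρ hB hC => ?_, ?_⟩
  · rcases hpat ρ with ⟨-, h2, -⟩ | ⟨-, h1, -⟩ | ⟨-, h1, -⟩
    exacts [h2 ((hb ρ).2 hB), h1 ((ha ρ).2 hA), h1 ((ha ρ).2 hA)]
  · rcases hpat ρ with ⟨-, -, h3⟩ | ⟨-, h1, -⟩ | ⟨-, h1, -⟩
    exacts [h3 ((hc ρ).2 hC), h1 ((ha ρ).2 hA), h1 ((ha ρ).2 hA)]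
  · rcases hpat ρ with ⟨-, h2, -⟩ | ⟨-, -, h3⟩ | ⟨-, -, h2⟩
    exacts [h2 ((hb ρ).2 hB), h3 ((hc ρ).2 hC), h2 ((hb ρ).2 hB)]
  · refine Finset.eq_univ_of_forall fun ρ => ?_
    simp only [Finset.mem_union]
    rcases hpat ρ with ⟨h1, -, -⟩ | ⟨h2, -, -⟩ | ⟨h3, -, -⟩
    · exact Or.inl (Or.inl ((ha ρ).1 h1))
    · exact Or.inl (Or.inr ((hb ρ).1 h2))
    · exact Or.inr ((hc ρ).1 h3)

end Block

/-! ## The Kronecker power along a free diagonal -/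

section Main

/-- A product of factors each squaring to one squares to one: `∏ w r * ∏ w r = 1` if
`w r * w r = 1` for all `r`. [folklore] -/
theorem prod_mul_prod_eq_one {m : ℕ} (w : Fin m → K) (hw : ∀ r, w r * w r = 1) :
    (∏ r, w r) * ∏ r, w r = 1 := by
  rw [← Finset.prod_mul_distrib]
  exact Finset.prod_eq_one fun r _ => hw r

/-- **Laser method, combinatorial-restriction form, for signed Coppersmith–Winograd block
structure** (BCS 1997, proof of Thm. 15.41, pp. 381–383, run for a tensor `T` whose three blocks
are signed permutation matrices `[y = σᵢ x] sᵢ x`, `sᵢ x = ±1` — "the same block structure as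
`T_cw,q`", CGLV 2022 §2.2): for a free diagonal `Δ` of balanced ordered partitions `(A,B,C)` of the
`N` positions there are index maps `F, G, H` and signs `φ, ψ` with
`⟨|Δ|⟩ ⊗ ⟨q^m,q^m,q^m⟩ = φ(x) ψ(y) · T^{⊗N}(F x, G y, H z)`, i.e. zeroing out, relabelling and
re-signing coordinates of `T^{⊗N}` leaves exactly `|Δ|` independent matrix products.
[cite: BurgisserClausenShokrollahi1997, Thm. 15.41 (proof, p. 381)] -/
theorem signedCw_kroneckerPow_blocks (q m N : ℕ) (T : Fin (q + 1) → Fin (q + 1) → Fin (q + 1) → K)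
    (σ₁ σ₂ σ₃ : Fin q → Fin q) (hσ₁ : Function.Injective σ₁) (hσ₂ : Function.Injective σ₂)
    (hσ₃ : Function.Injective σ₃) (s₁ s₂ s₃ : Fin q → K)
    (hs₁ : ∀ x, s₁ x * s₁ x = 1) (hs₂ : ∀ x, s₂ x * s₂ x = 1) (hs₃ : ∀ x, s₃ x * s₃ x = 1)
    (hT₁ : ∀ x y, T 0 x.succ y.succ = if y = σ₁ x then s₁ x else 0)
    (hT₂ : ∀ x y, T x.succ 0 y.succ = if y = σ₂ x then s₂ x else 0)
    (hT₃ : ∀ x y, T x.succ y.succ 0 = if y = σ₃ x then s₃ x else 0)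
    (hsupp : ∀ i j k, T i j k ≠ 0 →
      (i = 0 ∧ j ≠ 0 ∧ k ≠ 0) ∨ (j = 0 ∧ i ≠ 0 ∧ k ≠ 0) ∨ (k = 0 ∧ i ≠ 0 ∧ j ≠ 0))
    (Δ : Finset (Finset (Fin N) × Finset (Fin N) × Finset (Fin N)))
    (hcard : ∀ δ ∈ Δ, δ.1.card = m ∧ δ.2.1.card = m ∧ δ.2.2.card = m)
    (hpart : ∀ δ ∈ Δ, Disjoint δ.1 δ.2.1 ∧ Disjoint δ.1 δ.2.2 ∧ Disjoint δ.2.1 δ.2.2 ∧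
      δ.1 ∪ δ.2.1 ∪ δ.2.2 = Finset.univ)
    (hfree : ∀ δ ∈ Δ, ∀ δ' ∈ Δ, ∀ δ'' ∈ Δ, Disjoint δ.1 δ'.2.1 → Disjoint δ.1 δ''.2.2 →
      Disjoint δ'.2.1 δ''.2.2 → δ.1 ∪ δ'.2.1 ∪ δ''.2.2 = Finset.univ → δ = δ' ∧ δ' = δ'') :
    ∃ (F G H : Fin Δ.card × (Fin (q ^ m) × Fin (q ^ m)) → (Fin N → Fin (q + 1)))
      (φ ψ : Fin Δ.card × (Fin (q ^ m) × Fin (q ^ m)) → K),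
      kroneckerTensor (unitTensor K Δ.card) (matMulTensor K (q ^ m) (q ^ m) (q ^ m)) =
        fun x y z => φ x * ψ y * kroneckerPow T N (F x) (G y) (H z) := by
  classical
  -- enumerate `Δ` and its blocks
  let δ : Fin Δ.card → Finset (Fin N) × Finset (Fin N) × Finset (Fin N) :=
    fun s => (Δ.equivFin.symm s).1
  have hδmem : ∀ s, δ s ∈ Δ := fun s => (Δ.equivFin.symm s).2
  have hδinj : Function.Injective δ :=
    Subtype.val_injective.comp Δ.equivFin.symm.injective
  let eA : ∀ s, ↥(δ s).1 ≃ Fin m := fun s => Finset.equivFinOfCardEq (hcard _ (hδmem s)).1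
  let eB : ∀ s, ↥(δ s).2.1 ≃ Fin m := fun s => Finset.equivFinOfCardEq (hcard _ (hδmem s)).2.1
  let eC : ∀ s, ↥(δ s).2.2 ≃ Fin m := fun s => Finset.equivFinOfCardEq (hcard _ (hδmem s)).2.2
  -- `Fin (q^m)` as functions
  let f : Fin (q ^ m) → Fin m → Fin q := fun κ => finFunctionFinEquiv.symm κ
  have hf : ∀ κ κ' : Fin (q ^ m), f κ = f κ' ↔ κ = κ' := fun κ κ' =>
    finFunctionFinEquiv.symm.injective.eq_iff
  -- the index maps
  let F : Fin Δ.card × (Fin (q ^ m) × Fin (q ^ m)) → Fin N → Fin (q + 1) := fun x ρ =>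
    if h : ρ ∈ (δ x.1).2.2 then (f x.2.1 (eC x.1 ⟨ρ, h⟩)).succ
    else if h' : ρ ∈ (δ x.1).2.1 then (f x.2.2 (eB x.1 ⟨ρ, h'⟩)).succ else 0
  let G : Fin Δ.card × (Fin (q ^ m) × Fin (q ^ m)) → Fin N → Fin (q + 1) := fun y ρ =>
    if h : ρ ∈ (δ y.1).2.2 then (σ₃ (f y.2.1 (eC y.1 ⟨ρ, h⟩))).succ
    else if h' : ρ ∈ (δ y.1).1 then (f y.2.2 (eA y.1 ⟨ρ, h'⟩)).succ else 0
  let H : Fin Δ.card × (Fin (q ^ m) × Fin (q ^ m)) → Fin N → Fin (q + 1) := fun z ρ =>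
    if h : ρ ∈ (δ z.1).1 then (σ₁ (f z.2.1 (eA z.1 ⟨ρ, h⟩))).succ
    else if h' : ρ ∈ (δ z.1).2.1 then (σ₂ (f z.2.2 (eB z.1 ⟨ρ, h'⟩))).succ else 0
  -- the signs
  let φ : Fin Δ.card × (Fin (q ^ m) × Fin (q ^ m)) → K := fun x =>
    (∏ r, s₂ (f x.2.2 r)) * ∏ r, s₃ (f x.2.1 r)
  let ψ : Fin Δ.card × (Fin (q ^ m) × Fin (q ^ m)) → K := fun y => ∏ r, s₁ (f y.2.2 r)
  -- zero sets of the embedded indices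
  have hF0 : ∀ x ρ, F x ρ = 0 ↔ ρ ∈ (δ x.1).1 := by
    intro x ρ
    obtain ⟨hab, hac, hbc, hcov⟩ := hpart _ (hδmem x.1)
    simp only [F]
    constructor
    · intro h
      by_cases h1 : ρ ∈ (δ x.1).2.2
      · rw [dif_pos h1] at h; exact absurd h (Fin.succ_ne_zero _)
      · by_cases h2 : ρ ∈ (δ x.1).2.1
        · rw [dif_neg h1, dif_pos h2] at h; exact absurd h (Fin.succ_ne_zero _)
        · have := Finset.eq_univ_iff_forall.1 hcov ρ; simp only [Finset.mem_union] at this; tauto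
    · intro h
      rw [dif_neg (Finset.disjoint_left.1 hac h), dif_neg (Finset.disjoint_left.1 hab h)]
  have hG0 : ∀ y ρ, G y ρ = 0 ↔ ρ ∈ (δ y.1).2.1 := by
    intro y ρ
    obtain ⟨hab, hac, hbc, hcov⟩ := hpart _ (hδmem y.1)
    simp only [G]
    constructor
    · intro h
      by_cases h1 : ρ ∈ (δ y.1).2.2
      · rw [dif_pos h1] at h; exact absurd h (Fin.succ_ne_zero _)
      · by_cases h2 : ρ ∈ (δ y.1).1
        · rw [dif_neg h1, dif_pos h2] at h; exact absurd h (Fin.succ_ne_zero _)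
        · have := Finset.eq_univ_iff_forall.1 hcov ρ; simp only [Finset.mem_union] at this; tauto
    · intro h
      rw [dif_neg (Finset.disjoint_left.1 hbc h), dif_neg (Finset.disjoint_right.1 hab h)]
  have hH0 : ∀ z ρ, H z ρ = 0 ↔ ρ ∈ (δ z.1).2.2 := by
    intro z ρ
    obtain ⟨hab, hac, hbc, hcov⟩ := hpart _ (hδmem z.1)
    simp only [H]
    constructor
    · intro h
      by_cases h1 : ρ ∈ (δ z.1).1
      · rw [dif_pos h1] at h; exact absurd h (Fin.succ_ne_zero _)
      · by_cases h2 : ρ ∈ (δ z.1).2.1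
        · rw [dif_neg h1, dif_pos h2] at h; exact absurd h (Fin.succ_ne_zero _)
        · have := Finset.eq_univ_iff_forall.1 hcov ρ; simp only [Finset.mem_union] at this; tauto
    · intro h
      rw [dif_neg (Finset.disjoint_right.1 hac h), dif_neg (Finset.disjoint_right.1 hbc h)]
  -- signs square to one
  have hφ : ∀ x, φ x * φ x = 1 := by
    intro x
    have h2 := prod_mul_prod_eq_one _ (fun r => hs₂ (f x.2.2 r))
    have h3 := prod_mul_prod_eq_one _ (fun r => hs₃ (f x.2.1 r))
    simp only [φ]
    linear_combination ((∏ r, s₃ (f x.2.1 r)) * ∏ r, s₃ (f x.2.1 r)) * h2 + h3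
  have hψ : ∀ y, ψ y * ψ y = 1 := fun y => prod_mul_prod_eq_one _ (fun r => hs₁ _)
  refine ⟨F, G, H, φ, ψ, ?_⟩
  funext x y z
  obtain ⟨s, κ, ν⟩ := x
  obtain ⟨s', κ', μ⟩ := y
  obtain ⟨s'', μ', ν'⟩ := z
  rw [kroneckerTensor_apply, kroneckerPow_apply, unitTensor_apply]
  by_cases hs : s = s' ∧ s' = s''
  · -- a diagonal block: the matrix multiplication tensor, up to the sign `φ x ψ y`
    obtain ⟨rfl, rfl⟩ := hs
    rw [if_pos ⟨rfl, rfl⟩, one_mul]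
    obtain ⟨hab, hac, hbc, hcov⟩ := hpart _ (hδmem s)
    have key := signedCw_block_diag T σ₁ σ₂ σ₃ hσ₁ hσ₂ hσ₃ s₁ s₂ s₃ hT₁ hT₂ hT₃ hab hac hbc hcov
      (eA s) (eB s) (eC s) (f κ) (f ν) (f κ') (f μ) (f μ') (f ν')
      (F (s, κ, ν)) (G (s, κ', μ)) (H (s, μ', ν')) (fun ρ h => (hF0 _ ρ).2 h)
      (fun ρ h => by simp only [F]; rw [dif_pos h])
      (fun ρ h => by simp only [F]; rw [dif_neg (Finset.disjoint_left.1 hbc h), dif_pos h])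
      (fun ρ h => (hG0 _ ρ).2 h)
      (fun ρ h => by simp only [G]; rw [dif_pos h])
      (fun ρ h => by simp only [G]; rw [dif_neg (Finset.disjoint_left.1 hac h), dif_pos h])
      (fun ρ h => (hH0 _ ρ).2 h)
      (fun ρ h => by simp only [H]; rw [dif_pos h])
      (fun ρ h => by simp only [H]; rw [dif_neg (Finset.disjoint_right.1 hab h), dif_pos h])
    rw [key]
    simp only [matMulTensor]
    by_cases h : κ = κ' ∧ μ = μ' ∧ ν = ν'
    · obtain ⟨rfl, rfl, rfl⟩ := h
      rw [if_pos ⟨rfl, rfl, rfl⟩, if_pos ⟨rfl, rfl, rfl⟩]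
      have e : φ (s, κ, ν) * ψ (s, κ, μ) *
          ((∏ r, s₁ (f μ r)) * (∏ r, s₂ (f ν r)) * ∏ r, s₃ (f κ r)) =
          (φ (s, κ, ν) * φ (s, κ, ν)) * (ψ (s, κ, μ) * ψ (s, κ, μ)) := by
        simp only [φ, ψ]; ring
      rw [e, hφ, hψ, one_mul]
    · rw [if_neg h, if_neg fun h' => h ⟨(hf _ _).1 h'.1, (hf _ _).1 h'.2.1, (hf _ _).1 h'.2.2⟩,
        mul_zero]
  · -- an off-diagonal block vanishes, by freeness of `Δ`
    rw [if_neg hs, zero_mul]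
    by_cases hzero : kroneckerPow T N (F (s, κ, ν)) (G (s', κ', μ)) (H (s'', μ', ν')) = 0
    · rw [kroneckerPow_apply] at hzero
      rw [hzero, mul_zero]
    exfalso
    rw [kroneckerPow_apply] at hzero
    obtain ⟨h1, h2, h3, h4⟩ := signedCw_block_support T hsupp (F (s, κ, ν)) (G (s', κ', μ))
      (H (s'', μ', ν')) (hF0 _) (hG0 _) (hH0 _) hzero
    obtain ⟨e1, e2⟩ := hfree _ (hδmem s) _ (hδmem s') _ (hδmem s'') h1 h2 h3 h4
    exact hs ⟨hδinj e1, hδinj e2⟩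

/-- **Weighted relabelling along index maps is a restriction**: for index maps `f, g, h` and
weights `φ, ψ`, `t ≥ (φ(a) ψ(b) · t (f a) (g b) (h c))_{a,b,c}` (the matrices `A = diag(φ) f^*`,
`B = diag(ψ) g^*`, `C = h^*`; Bläser 2013, Def. 7.2 / Lemma 5.4). [cite: Blaser2013, Def. 7.2] -/
theorem tensorRestrictsTo_precomp_mul {ι κ μ ι' κ' μ' : Type*} [Fintype ι] [Fintype κ] [Fintype μ]
    [DecidableEq ι] [DecidableEq κ] [DecidableEq μ] (t : ι → κ → μ → K) (f : ι' → ι) (g : κ' → κ)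
    (h : μ' → μ) (φ : ι' → K) (ψ : κ' → K) :
    TensorRestrictsTo t (fun a b c => φ a * ψ b * t (f a) (g b) (h c)) := by
  refine ⟨fun a' a => if f a' = a then φ a' else 0, fun b' b => if g b' = b then ψ b' else 0,
    fun c' c => if h c' = c then 1 else 0, fun a' b' c' => ?_⟩
  rw [Finset.sum_eq_single (f a') (fun a _ ha => by simp [Ne.symm ha]) (by simp),
    Finset.sum_eq_single (g b') (fun b _ hb => by simp [Ne.symm hb]) (by simp),
    Finset.sum_eq_single (h c') (fun c _ hc => by simp [Ne.symm hc]) (by simp)]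
  simp

/-- **`T^{⊗3m} ≥ ⟨p_m⟩ ⊗ ⟨q^m, q^m, q^m⟩` with `288 C(2m,m) p_m ≥ C(3m,m) · rothNumberNat(3 C(2m,m))`**
for every tensor `T` with signed Coppersmith–Winograd block structure (BCS p. 381:
`⊕_{Δ} t^{⊗N}(x,y,z) ≤ t^{⊗N}`, `|Δ| ≥ C min binom`, each component `≃ ⟨q^{N/3},q^{N/3},q^{N/3}⟩`),
as a genuine restriction: the free balanced diagonal of `exists_free_balanced_diagonal` and
`signedCw_kroneckerPow_blocks`. [cite: BurgisserClausenShokrollahi1997, Thm. 15.41 (proof, p. 381)] -/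
theorem exists_restrictsTo_signedCw_kroneckerPow (q m : ℕ) (hm : 1 ≤ m)
    (T : Fin (q + 1) → Fin (q + 1) → Fin (q + 1) → K)
    (σ₁ σ₂ σ₃ : Fin q → Fin q) (hσ₁ : Function.Injective σ₁) (hσ₂ : Function.Injective σ₂)
    (hσ₃ : Function.Injective σ₃) (s₁ s₂ s₃ : Fin q → K)
    (hs₁ : ∀ x, s₁ x * s₁ x = 1) (hs₂ : ∀ x, s₂ x * s₂ x = 1) (hs₃ : ∀ x, s₃ x * s₃ x = 1)
    (hT₁ : ∀ x y, T 0 x.succ y.succ = if y = σ₁ x then s₁ x else 0)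
    (hT₂ : ∀ x y, T x.succ 0 y.succ = if y = σ₂ x then s₂ x else 0)
    (hT₃ : ∀ x y, T x.succ y.succ 0 = if y = σ₃ x then s₃ x else 0)
    (hsupp : ∀ i j k, T i j k ≠ 0 →
      (i = 0 ∧ j ≠ 0 ∧ k ≠ 0) ∨ (j = 0 ∧ i ≠ 0 ∧ k ≠ 0) ∨ (k = 0 ∧ i ≠ 0 ∧ j ≠ 0)) :
    ∃ p : ℕ, (3 * m).choose m * rothNumberNat (3 * (2 * m).choose m) ≤ 288 * (2 * m).choose m * p ∧
      TensorRestrictsTo (kroneckerPow T (3 * m))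
        (kroneckerTensor (unitTensor K p) (matMulTensor K (q ^ m) (q ^ m) (q ^ m))) := by
  classical
  obtain ⟨Δ, hcard, hpart, hfree, hsize⟩ := exists_free_balanced_diagonal m hm
  obtain ⟨F, G, H, φ, ψ, hFGH⟩ := signedCw_kroneckerPow_blocks q m (3 * m) T σ₁ σ₂ σ₃ hσ₁ hσ₂ hσ₃
    s₁ s₂ s₃ hs₁ hs₂ hs₃ hT₁ hT₂ hT₃ hsupp Δ hcard hpart hfree
  refine ⟨Δ.card, hsize, ?_⟩
  rw [hFGH]
  exact tensorRestrictsTo_precomp_mul _ F G H φ ψ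

end Main

end Summit.MatrixMultiplication.MatrixMultiplication.Theorems

end
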